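import Mathlib
import Summits.Ventures.LatticeQCDFlow.Scaling.EntropyBudget

/-!
# LatticeQCDFlow / Scaling — the entropy budget of an exact flow, II: free energies

HONEST FRAMING: exact (Metropolis-corrected) sampling algorithms for lattice gauge theory;
figures of merit are autocorrelation/cost numbers at stated couplings and volumes; no
continuum-physics claim.

Venture `LatticeQCDFlow` (cell pub-lqcd), topic `Scaling`, THEORY-2.md §3.2 v2.0 / §4 row T2-AH(a)
(theory seat GEN-9).  Continues `Scaling/EntropyBudget.lean`.  For the tilted law
`p_β = η·e^{−βS}/Z(β)` (`tiltLaw η S β`, `tiltZ`) on a finite space: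

* `klFin_tiltLaw` — the **Gibbs identity** `D(p_β‖η) = −β·⟨S⟩_β − log Z(β)`;
* `klFin_tiltLaw_le` — `D(p_β‖η) ≤ −log Z(β)` for `β ≥ 0`, `S ≥ 0`;
* `tiltZ_ge_sublevel` — Chernoff: `Z(β) ≥ e^{−βt}·η{S ≤ t}` (`β ≥ 0`);
* `mean_action_le` — the convexity sandwich `(β − β₁)·⟨S⟩_β ≤ log Z(β₁) − log Z(β)`;
* `klFin_tiltLaw_ge` — the **two-free-energies bound**
  `(β − β₁)·D(p_β‖η) ≥ β₁·log Z(β) − β·log Z(β₁)` (`0 ≤ β`, any `β₁`), special case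
  `klFin_tiltLaw_ge_half : D(p_β‖η) ≥ log Z(β) − 2·log Z(β/2)`;
* `entropyBudget` — assembly with part I: for a flow `T_*ν` with prior density `≤ M` and volume
  distortion `≤ J` relative to `η`,
  `β₁·log Z(β) − β·log Z(β₁) ≤ (β − β₁)·(log M + log J − log ESS(p_β, T_*ν))`.

On the lattice the free energies are those of the Wilson action against product Haar measure and
`log Z_Λ(β) = −(dim G·|E¹_Λ|/2)·log β + O(|Λ|)` (THEORY-2.md §3.2 v2.0 and the sources cited in
part I) turns the right-hand side into `(n_tr/2)(1 − O(1/L))·log β − O(V)`.  Not formalised here;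
everything below is an elementary finite-sum theorem, `[folklore]` level, no `sorry`.
-/

namespace Summit.Ventures.LatticeQCDFlow.Theory2

open Finset

variable {X : Type*} [Fintype X]

/-! ## 5. The Gibbs side: tilted laws, free energies, and the two-free-energies bound -/

/-- Partition sum of the tilted law `η·e^{−βS}`. -/
noncomputable def tiltZ (η S : X → ℝ) (β : ℝ) : ℝ := ∑ x, η x * Real.exp (-(β * S x))

/-- The tilted (Boltzmann) law relative to the reference weights `η`: `p_β = η·e^{−βS}/Z(β)`. -/
noncomputable def tiltLaw (η S : X → ℝ) (β : ℝ) (x : X) : ℝ :=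
  η x * Real.exp (-(β * S x)) / tiltZ η S β

/-- The tilted partition sum is positive (positive reference, nonempty space). -/
theorem tiltZ_pos {η : X → ℝ} [Nonempty X] (hη : ∀ x, 0 < η x) (S : X → ℝ) (β : ℝ) :
    0 < tiltZ η S β :=
  sum_pos (fun x _ => mul_pos (hη x) (Real.exp_pos _)) univ_nonempty

/-- The tilted law is positive. -/
theorem tiltLaw_pos {η : X → ℝ} [Nonempty X] (hη : ∀ x, 0 < η x) (S : X → ℝ) (β : ℝ) (x : X) :
    0 < tiltLaw η S β x :=
  div_pos (mul_pos (hη x) (Real.exp_pos _)) (tiltZ_pos hη S β)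

/-- The tilted law is normalised: `Σ p_β = 1`. -/
theorem sum_tiltLaw {η : X → ℝ} [Nonempty X] (hη : ∀ x, 0 < η x) (S : X → ℝ) (β : ℝ) :
    ∑ x, tiltLaw η S β x = 1 := by
  unfold tiltLaw
  rw [← sum_div, ← tiltZ, div_self (tiltZ_pos hη S β).ne']

/-- At `β = 0` the tilted law is the (normalised) reference: `Z(0) = Σ η`. -/
theorem tiltZ_zero (η S : X → ℝ) : tiltZ η S 0 = ∑ x, η x := by
  simp [tiltZ]

/-- **Gibbs identity.**  `D(p_β‖η) = −β·⟨S⟩_β − log Z(β)`. [folklore] -/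
theorem klFin_tiltLaw {η : X → ℝ} [Nonempty X] (hη : ∀ x, 0 < η x) (S : X → ℝ) (β : ℝ) :
    klFin (tiltLaw η S β) η =
      -(β * ∑ x, tiltLaw η S β x * S x) - Real.log (tiltZ η S β) := by
  have hZ := tiltZ_pos hη S β
  have hterm : ∀ x, tiltLaw η S β x * Real.log (tiltLaw η S β x / η x) =
      tiltLaw η S β x * (-(β * S x)) - tiltLaw η S β x * Real.log (tiltZ η S β) := by
    intro x
    have e : tiltLaw η S β x / η x = Real.exp (-(β * S x)) / tiltZ η S β := by
      unfold tiltLaw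
      have := (hη x).ne'
      have := hZ.ne'
      field_simp
    rw [e, Real.log_div (Real.exp_pos _).ne' hZ.ne', Real.log_exp, mul_sub]
  unfold klFin
  simp_rw [hterm]
  rw [sum_sub_distrib, ← sum_mul, sum_tiltLaw hη, one_mul, mul_sum]
  congr 1
  rw [← sum_neg_distrib]
  exact sum_congr rfl fun x _ => by ring

/-- `D(p_β‖η) ≤ −log Z(β)` when `β ≥ 0` and `S ≥ 0` (the action term only helps). -/
theorem klFin_tiltLaw_le {η : X → ℝ} [Nonempty X] (hη : ∀ x, 0 < η x) {S : X → ℝ}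
    (hS : ∀ x, 0 ≤ S x) {β : ℝ} (hβ : 0 ≤ β) :
    klFin (tiltLaw η S β) η ≤ -Real.log (tiltZ η S β) := by
  rw [klFin_tiltLaw hη S β]
  have : 0 ≤ β * ∑ x, tiltLaw η S β x * S x :=
    mul_nonneg hβ (sum_nonneg fun x _ => mul_nonneg (tiltLaw_pos hη S β x).le (hS x))
  linarith

/-- **Chernoff / sublevel bound.**  `Z(β) ≥ e^{−βt} · η{S ≤ t}` for `β ≥ 0`. [folklore] -/
theorem tiltZ_ge_sublevel {η : X → ℝ} (hη : ∀ x, 0 < η x) (S : X → ℝ) {β : ℝ} (hβ : 0 ≤ β)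
    (t : ℝ) [DecidablePred fun x => S x ≤ t] :
    Real.exp (-(β * t)) * ∑ x ∈ univ.filter (fun x => S x ≤ t), η x ≤ tiltZ η S β := by
  rw [mul_sum]
  calc ∑ x ∈ univ.filter (fun x => S x ≤ t), Real.exp (-(β * t)) * η x
      ≤ ∑ x ∈ univ.filter (fun x => S x ≤ t), η x * Real.exp (-(β * S x)) := by
        refine sum_le_sum fun x hx => ?_
        rw [mem_filter] at hx
        rw [mul_comm]
        exact mul_le_mul_of_nonneg_left
          (Real.exp_le_exp.mpr (by nlinarith [hx.2])) (hη x).le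
    _ ≤ tiltZ η S β :=
        sum_le_sum_of_subset_of_nonneg (filter_subset _ _)
          fun x _ _ => (mul_pos (hη x) (Real.exp_pos _)).le

/-- `Z(β₁)/Z(β) = ⟨e^{(β−β₁)S}⟩_β`. -/
theorem tiltZ_div_eq_sum {η : X → ℝ} [Nonempty X] (hη : ∀ x, 0 < η x) (S : X → ℝ) (β β₁ : ℝ) :
    tiltZ η S β₁ / tiltZ η S β = ∑ x, tiltLaw η S β x * Real.exp ((β - β₁) * S x) := by
  have hZ := tiltZ_pos hη S β
  rw [div_eq_iff hZ.ne', sum_mul]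
  show ∑ x, η x * Real.exp (-(β₁ * S x)) = _
  refine sum_congr rfl fun x _ => ?_
  rw [tiltLaw, div_mul_eq_mul_div, div_mul_cancel₀ _ hZ.ne', mul_assoc, ← Real.exp_add]
  congr 2
  ring

/-- **Convexity sandwich.**  `(β − β₁)·⟨S⟩_β ≤ log Z(β₁) − log Z(β)` (Jensen: `log Z` is convex
in `β` with slope `−⟨S⟩_β`). [folklore] -/
theorem mean_action_le {η : X → ℝ} [Nonempty X] (hη : ∀ x, 0 < η x) (S : X → ℝ) (β β₁ : ℝ) :
    (β - β₁) * ∑ x, tiltLaw η S β x * S x ≤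
      Real.log (tiltZ η S β₁) - Real.log (tiltZ η S β) := by
  have hp := tiltLaw_pos hη S β
  have hp1 := sum_tiltLaw hη S β
  -- Jensen for `exp`
  have hj := convexOn_exp.map_sum_le (t := univ) (w := fun x => tiltLaw η S β x)
    (p := fun x => (β - β₁) * S x) (fun x _ => (hp x).le) hp1 (fun x _ => Set.mem_univ _)
  simp only [smul_eq_mul] at hj
  rw [← tiltZ_div_eq_sum hη S β β₁] at hj
  have hlog := Real.log_le_log (Real.exp_pos _) hj
  rw [Real.log_exp, Real.log_div (tiltZ_pos hη S β₁).ne' (tiltZ_pos hη S β).ne'] at hlog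
  calc (β - β₁) * ∑ x, tiltLaw η S β x * S x = ∑ x, tiltLaw η S β x * ((β - β₁) * S x) := by
        rw [mul_sum]; exact sum_congr rfl fun x _ => by ring
    _ ≤ Real.log (tiltZ η S β₁) - Real.log (tiltZ η S β) := hlog

/-- **T2-AH (two-free-energies bound).**  `(β − β₁)·D(p_β‖η) ≥ β₁·log Z(β) − β·log Z(β₁)` for
`0 ≤ β` and any `β₁` (useful for `β₁ < β`): the entropy deficit of the tilted law is bounded BELOW
by free energies at two
couplings — on the lattice, by the free-energy asymptotics `log Z_Λ(β) = −(n_tr/2) log β + O(V)`,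
giving `D(p_β‖Haar) ≥ (n_tr/2)(1 − O(1/L)) log β − O(V)` (THEORY-2.md §3.2 v2.0). -/
theorem klFin_tiltLaw_ge {η : X → ℝ} [Nonempty X] (hη : ∀ x, 0 < η x) (S : X → ℝ) {β : ℝ}
    (hβ0 : 0 ≤ β) (β₁ : ℝ) :
    β₁ * Real.log (tiltZ η S β) - β * Real.log (tiltZ η S β₁) ≤
      (β - β₁) * klFin (tiltLaw η S β) η := by
  rw [klFin_tiltLaw hη S β]
  have h := mean_action_le hη S β β₁
  -- multiply the sandwich by β ≥ 0 and rearrange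
  have h2 := mul_le_mul_of_nonneg_left h hβ0
  nlinarith [h2, h, hβ0]

/-- Special case `β₁ = β/2`: `D(p_β‖η) ≥ log Z(β) − 2·log Z(β/2)`. -/
theorem klFin_tiltLaw_ge_half {η : X → ℝ} [Nonempty X] (hη : ∀ x, 0 < η x) (S : X → ℝ) {β : ℝ}
    (hβ : 0 < β) :
    Real.log (tiltZ η S β) - 2 * Real.log (tiltZ η S (β / 2)) ≤ klFin (tiltLaw η S β) η := by
  have h := klFin_tiltLaw_ge hη S (β := β) hβ.le (β / 2)
  rw [show β - β / 2 = β / 2 by ring] at h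
  have hβ2 : (0:ℝ) < β / 2 := by linarith
  have key : β / 2 * (Real.log (tiltZ η S β) - 2 * Real.log (tiltZ η S (β / 2))) ≤
      β / 2 * klFin (tiltLaw η S β) η := by
    have e : β / 2 * (Real.log (tiltZ η S β) - 2 * Real.log (tiltZ η S (β / 2))) =
        β / 2 * Real.log (tiltZ η S β) - β * Real.log (tiltZ η S (β / 2)) := by ring
    rw [e]; exact h
  exact le_of_mul_le_mul_left key hβ2

/-! ## 6. Assembly: the entropy budget of a flow against a tilted target -/

/-- **ENTROPY-BUDGET LAW (finite skeleton of THEORY-2 §3.2 v2.0).**  For the tilted target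
`p_β = η e^{−βS}/Z(β)`, a prior of density `≤ M` and a flow of volume distortion `≤ J` (both
relative to `η`), and any `0 ≤ β`, `β₁ ≤ β`:
`(β − β₁)·(log M + log J − log ESS) ≥ β₁·log Z(β) − β·log Z(β₁)`.
With `η` = Haar, `ν` = Haar (`M = 1`) this reads `log J ≥ D(p_β‖Haar) − log(1/ESS)`, and the
right-hand side is `(n_tr/2)·log β − O(V)` on the lattice. -/
theorem entropyBudget (T : X ≃ X) {ν η : X → ℝ} [Nonempty X] (hν : ∀ x, 0 < ν x)
    (hη : ∀ x, 0 < η x) (S : X → ℝ) {β β₁ M J : ℝ} (hβ0 : 0 ≤ β) (hβ : β₁ ≤ β)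
    (hM : ∀ x, ν x ≤ M * η x) (hJ : ∀ y, η (T.symm y) ≤ J * η y) :
    β₁ * Real.log (tiltZ η S β) - β * Real.log (tiltZ η S β₁) ≤
      (β - β₁) * (Real.log M + Real.log J - Real.log (essFrac (tiltLaw η S β) (pushLaw T ν))) := by
  have h1 := klFin_tiltLaw_ge hη S hβ0 β₁
  have h2 := klFin_add_log_essFrac_le T (tiltLaw_pos hη S β) (sum_tiltLaw hη S β) hν hη hM hJ
  have hβ0 : 0 ≤ β - β₁ := by linarith
  nlinarith [mul_le_mul_of_nonneg_left h2 hβ0]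

end Summit.Ventures.LatticeQCDFlow.Theory2
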